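import Mathlib
import Literature.Analysis.FluidPDE.Tao2016AveragedNS.ShiftSetCascadeFlows
import Summits.NavierStokesRegularity.NavierStokesRegularity.Theorems.TaoLadderRungTwoFlatCertificateGlueCheckerFrameOn
import Summits.NavierStokesRegularity.NavierStokesRegularity.Theorems.TaoLadderRungTwoFlatCertificateGlueJacobianFieldOn
import HarnessLib

/-!
# Certificate glue on a shift set `𝕊`, XXXVIII-c: THE ALL-DIRECTIONS VARIATIONAL TABLE OVER SPARSE INTERVAL JACOBIANS — `varMatStepA`,
  `varMatLevelsA`, `jacLevelsA`, `colMatBoxA`, their soundness `mem_varMatLevelsA`, and the frame-enclosure columns `vcolsJ` with `mem_wMatJ`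
  (the twin of glue XXVI `vcolsA` / `mem_wMat`) (helper for items stmt-NavierStokesRegularity-22987 `FlatGapCertificatesV2` (crux K_A♭ of route
  TaoLadderRungTwoFlat) and stmt-24295 K_A₂(64); cell harvest/h2-tao-ladder, p1 g18; PERFORMANCE refactor of the step checker)

THE RECURSION. For a quadratic field `Q` with Taylor jets `T y i` of the centre and variational jets `U y v k` (pub-ns-dss's `taylorJet` / `varJet`:
`(k+1)·U_{k+1} = Σ_{i≤k} (Q (T i) (U_{k−i}) + Q (U_{k−i}) (T i))`), the bracket is LINEAR in `U_{k−i}`: it is the Jacobian row functional of glue XXXVIII-b at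
`T i`. Hence ALL `n` directions `v = C e_j` are propagated at once as an `n × n` interval matrix per level (flattened column-major, entry `(c, j)` at
`j·n + c`): `V_{k+1}[c][j] = (Σ_{i≤k} rowApply (J_i[c]) (V_{k−i}[·][j])) / (k+1)` with `J_i = Jf (X_i)` the sparse Jacobian on the state level `X_i`.
Cost per step at `n = 98`, `p = 16`, `S♭`: `136` sparse products with `≤ 6` entries per row ≈ `8·10⁶` interval operations, against `98 × 272` field
evaluations (≈ `7·10⁸` operations) for the per-column jets of `vcolsA`.

* `mem_varMatLevelsA` — generic soundness: `U y (v_j) k c ∈ V_k[c][j]` for state levels enclosing `T y i` and an initial matrix enclosing the `v_j`;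
* `vcolsJ` — the columns of `W = V_h C` (Horner values at `H`), same shape as `vcolsA`; `mem_wMatJ` — entries of `wMat` are enclosed.

HONEST FRAMING: Tao-type MODEL lattices (Tao 2016 §4/§6 vocabulary, shift-set parametrised); interval-arithmetic soundness — no certificate data, nothing
certified, no stub closed, nothing here is a statement about the Navier–Stokes equations.
-/

-- the sub-problem namespace repeats the summit name by design (D-0017)
set_option linter.dupNamespace false

namespace Summit.NavierStokesRegularity.NavierStokesRegularity.Theorems

open Set Finset Literature.Analysis.FluidPDE Literature.Analysis.FluidPDE.TaoCascade
open Summit.NavierStokesRegularity.NavierStokesRegularity.Theorems.TaylorModelCert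
open Summit.NavierStokesRegularity.NavierStokesRegularity.Theorems.TaylorModelReadout

namespace CertificateGlueOn

/-! ### Readers and flat indices -/

/-- Table `i` of a table of row tables (junk `#[]` beyond the size). [folklore] -/
def tget (Js : Array (Array (List (ℕ × IntervalD)))) (i : ℕ) : Array (List (ℕ × IntervalD)) := if h : i < Js.size then Js[i] else #[]

/-- `tget` of `Array.ofFn`. [folklore] -/
theorem tget_ofFn {K : ℕ} (F : Fin K → Array (List (ℕ × IntervalD))) {i : ℕ} (hi : i < K) : tget (Array.ofFn F) i = F ⟨i, hi⟩ := by
  unfold tget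
  rw [dif_pos (by rw [Array.size_ofFn]; exact hi), Array.getElem_ofFn]

/-- Row `c` of table `i`. [folklore] -/
def jrow (Js : Array (Array (List (ℕ × IntervalD)))) (i c : ℕ) : List (ℕ × IntervalD) := rget (tget Js i) c

/-! ### The all-directions variational table: the executable side -/

/-- Level `k+1` of the all-directions variational table from levels `0..k` (`Us`, flattened column-major: entry `(c, j)` at `j·n + c`), given the Jacobian
rows `Js[i]` of the state levels: `V_{k+1}[c][j] = (Σ_{i≤k} Σ_{(e,B) ∈ J_i[c]} B ⊗ V_{k−i}[e][j]) / (k+1)`. [folklore] -/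
def varMatStepA (n prec : ℕ) (Js : Array (Array (List (ℕ × IntervalD)))) (k : ℕ) (Us : Array (Array IntervalD)) : Array IntervalD :=
  Array.ofFn fun t : Fin (n * n) =>
    IntervalD.divNat prec
      (IntervalD.rangeSumR prec
        (fun i => rowApply prec (fun e => IntervalD.aget (IntervalD.lget Us (k - i)) (t.val / n * n + e)) (jrow Js i (t.val % n))) (k + 1))
      (k + 1)

/-- The all-directions variational levels `0..K` from the initial (flattened) direction matrix `D`. [folklore] -/
def varMatLevelsA (n prec : ℕ) (Js : Array (Array (List (ℕ × IntervalD)))) (D : Array IntervalD) : ℕ → Array (Array IntervalD) :=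
  IntervalD.buildLevels (varMatStepA n prec Js) D

/-- The Jacobian tables of the state levels `0..K`. [folklore] -/
def jacLevelsA (Jf : Array IntervalD → Array (List (ℕ × IntervalD))) (Ls : Array (Array IntervalD)) (K : ℕ) :
    Array (Array (List (ℕ × IntervalD))) :=
  Array.ofFn fun i : Fin (K + 1) => Jf (IntervalD.lget Ls i)

/-- A dyadic matrix as point boxes, flattened column-major (`(c, j) ↦ j·n + c`). [folklore] -/
def colMatBoxA (n : ℕ) (C : Array (Array Dyad)) : Array IntervalD :=
  Array.ofFn fun t : Fin (n * n) => IntervalD.ofDyad (dmgetD C (t.val % n) (t.val / n))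

/-- Step outputs have size `n²`. [folklore] -/
theorem size_varMatStepA (n prec : ℕ) (Js : Array (Array (List (ℕ × IntervalD)))) (k : ℕ) (Us : Array (Array IntervalD)) :
    (varMatStepA n prec Js k Us).size = n * n := by
  simp only [varMatStepA, Array.size_ofFn]

/-! ### Soundness of the recursion -/

/-- **THE ALL-DIRECTIONS VARIATIONAL TABLE ENCLOSES THE VARIATIONAL JETS OF EVERY DIRECTION**: if `Jf` is a sparse interval Jacobian of `Q`, the state
levels `Ls` enclose the Taylor jets `T y i` (`i ≤ K`) and the initial matrix `D` encloses the directions `vs j` (`j < n`) column-major, then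
`U y (vs j) k c ∈ V_k[c][j]` for all `k ≤ K`. [cite: Zgliczynski2002C1Lohner, §3–4 (the variational part, propagated as a matrix); cell certificate format, checker clauses] -/
theorem mem_varMatLevelsA {n : ℕ} {Q : (Fin n → ℝ) → (Fin n → ℝ) → Fin n → ℝ} {Jf : Array IntervalD → Array (List (ℕ × IntervalD))}
    (hJ : IsJacEnclosureA Q Jf) (prec K : ℕ) {Ls : Array (Array IntervalD)} {y : Fin n → ℝ}
    (hT : ∀ i ≤ K, ∀ c < n, IntervalD.mem (rdN (taylorJet Q y i) c) (IntervalD.aget (IntervalD.lget Ls i) c))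
    {D : Array IntervalD} {vs : ℕ → Fin n → ℝ} (hv : ∀ j < n, ∀ c < n, IntervalD.mem (rdN (vs j) c) (IntervalD.aget D (j * n + c))) :
    ∀ k ≤ K, ∀ j < n, ∀ c < n,
      IntervalD.mem (rdN (varJet Q y (vs j) k) c) (IntervalD.aget (IntervalD.lget (varMatLevelsA n prec (jacLevelsA Jf Ls K) D K) k) (j * n + c)) := by
  have hflat : ∀ {j c : ℕ}, j < n → c < n → j * n + c < n * n ∧ (j * n + c) / n = j ∧ (j * n + c) % n = c :=
    fun {j c} hj hc => ⟨by nlinarith [Nat.mul_le_mul_right n (Nat.succ_le_of_lt hj)],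
      by rw [add_comm, Nat.add_mul_div_right _ _ (Nat.zero_lt_of_lt hc), Nat.div_eq_of_lt hc, zero_add],
      by rw [add_comm, Nat.add_mul_mod_self_right, Nat.mod_eq_of_lt hc]⟩
  intro k
  induction k using Nat.strong_induction_on with
  | _ k ih =>
    intro hk j hj c hc
    cases k with
    | zero =>
      unfold varMatLevelsA
      rw [IntervalD.lget_buildLevels_zero, varJet_zero]
      exact hv j hj c hc
    | succ k =>
      unfold varMatLevelsA
      rw [IntervalD.lget_buildLevels_of_le _ D hk, IntervalD.lget_buildLevels_succ]
      unfold varMatStepA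
      rw [IntervalD.aget_ofFn _ (hflat hj hc).1]
      dsimp only
      rw [(hflat hj hc).2.1, (hflat hj hc).2.2, rdN_of_lt _ hc]
      -- the real recursion, solved for the top jet
      have hrec := varJet_succ_apply Q y (vs j) k ⟨c, hc⟩
      have e : varJet Q y (vs j) (k + 1) ⟨c, hc⟩ =
          (∑ i ∈ Finset.range (k + 1), (Q (taylorJet Q y i) (varJet Q y (vs j) (k - i)) ⟨c, hc⟩ +
            Q (varJet Q y (vs j) (k - i)) (taylorJet Q y i) ⟨c, hc⟩)) / ((k + 1 : ℕ) : ℝ) := by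
        rw [eq_div_iff (by positivity), Nat.cast_succ, mul_comm]
        exact hrec
      rw [e]
      refine IntervalD.mem_divNat prec (IntervalD.mem_rangeSumR prec (k + 1) fun i hi => ?_) (Nat.succ_pos k)
      -- one bracket: the Jacobian row at level `i` applied to column `j` of level `k - i`
      have hiK : i ≤ K := by omega
      obtain ⟨σ, hok, hproj, hbd, hval⟩ := hJ (IntervalD.lget Ls i) (taylorJet Q y i) (hT i hiK) ⟨c, hc⟩
      have hrow : jrow (jacLevelsA Jf Ls K) i c = projRow σ := by
        unfold jrow jacLevelsA
        rw [tget_ofFn _ (by omega : i < K + 1), hproj]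
      rw [hrow, hval]
      refine mem_rowApply prec hok fun t ht => ?_
      have htn := hbd t ht
      have hki : k - i < k + 1 := by omega
      have h := ih (k - i) hki (by omega) j hj t.1 htn
      unfold varMatLevelsA at h
      rw [IntervalD.lget_buildLevels_of_le _ D (by omega : k - i ≤ K)] at h
      rw [IntervalD.lget_buildLevels_of_le _ D (Nat.sub_le k i)]
      exact h

/-! ### The frame-enclosure columns -/

variable {m : ℕ} {Kb Ka : ℤ} {ω : Fin m → ℤ → ℝ} {ε₀ : ℝ} {α : Fin m → Fin m → Fin m → ℤ × ℤ × ℤ → ℝ}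
  {shifts : List (ℤ × ℤ × ℤ)} {prec : ℕ} {coefB : Fin m → ℤ → Fin m → Fin m → ℤ × ℤ × ℤ → IntervalD}

/-- **THE COLUMNS OF `W = V_h C` VIA THE SPARSE JACOBIAN** (twin of glue XXVI `vcolsA`, same shape): column `j`, entry `c` = Horner value at `H` of
entry `(c, j)` of the all-directions variational levels along the state jet table `JETS` (= `jetLevelsA n pqBoxA prec X p`, computed once).
[cite: Zgliczynski2002C1Lohner, §3–4 (the variational part, propagated as a matrix); cell certificate format, checker clauses] -/
def vcolsJ (Kb Ka : ℤ) (prec : ℕ) (shifts : List (ℤ × ℤ × ℤ))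
    (coefB : Fin m → ℤ → Fin m → Fin m → ℤ × ℤ × ℤ → IntervalD) (p : ℕ) (JETS : Array (Array IntervalD)) (H : IntervalD)
    (C : Array (Array Dyad)) : Array (Array IntervalD) :=
  let n := m * winLen Kb Ka
  let P := IntervalD.polyLevelsA (n * n) prec
    (varMatLevelsA n prec (jacLevelsA (pqJacA Kb Ka prec shifts coefB) JETS p) (colMatBoxA n C) p) p H
  Array.ofFn fun j : Fin n => Array.ofFn fun c : Fin n => IntervalD.aget P (j.val * n + c.val)

/-- Column `j` of a dyadic matrix as a real vector (ℕ-indexed column). [folklore] -/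
noncomputable def colN {n : ℕ} (C : Array (Array Dyad)) (j : ℕ) : Fin n → ℝ := fun d => (dmgetD C d j).toReal

/-- **ENTRIES OF `W` ARE ENCLOSED BY `vcolsJ`** (twin of glue XXVI `mem_wMat`). [cite: Zgliczynski2002C1Lohner, §3–4 (the variational part); cell certificate format, checker clauses] -/
theorem mem_wMatJ (hKb : 0 ≤ Kb) (hKa : 1 ≤ Ka) (hnd : shifts.Nodup) (hcoef : CoefBoxOK shifts ε₀ α Kb Ka ω coefB) (p : ℕ)
    {X : Array IntervalD} (hX : X.size = m * winLen Kb Ka) {x : Fin (m * winLen Kb Ka) → ℝ}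
    (hx : ∀ c < m * winLen Kb Ka, IntervalD.mem (rdN x c) (IntervalD.aget X c)) {H : IntervalD} {u : ℝ}
    (hu : IntervalD.mem u H) (C : Array (Array Dyad)) (c j : Fin (m * winLen Kb Ka)) :
    IntervalD.mem (wMat (PQcN shifts.toFinset ε₀ α Kb Ka ω) p x (dmat (n := m * winLen Kb Ka) C) u c j)
      (IntervalD.aget (IntervalD.lget (vcolsJ Kb Ka prec shifts coefB p
        (IntervalD.jetLevelsA (m * winLen Kb Ka) (pqBoxA Kb Ka prec shifts coefB) prec X p) H C) j) c) := by
  have hflat : ∀ {j c : ℕ}, j < (m * winLen Kb Ka) → c < (m * winLen Kb Ka) → j * (m * winLen Kb Ka) + c < (m * winLen Kb Ka) * (m * winLen Kb Ka) ∧ (j * (m * winLen Kb Ka) + c) / (m * winLen Kb Ka) = j ∧ (j * (m * winLen Kb Ka) + c) % (m * winLen Kb Ka) = c :=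
    fun {j c} hj hc => ⟨by nlinarith [Nat.mul_le_mul_right (m * winLen Kb Ka) (Nat.succ_le_of_lt hj)],
      by rw [add_comm, Nat.add_mul_div_right _ _ (Nat.zero_lt_of_lt hc), Nat.div_eq_of_lt hc, zero_add],
      by rw [add_comm, Nat.add_mul_mod_self_right, Nat.mod_eq_of_lt hc]⟩
  -- the all-directions table encloses every variational jet of every column direction
  have hjets := mem_varMatLevelsA (Q := PQcN shifts.toFinset ε₀ α Kb Ka ω) (isJacEnclosureA_pqJacA (prec := prec) hKb hKa hnd hcoef) prec p
    (Ls := IntervalD.jetLevelsA (m * winLen Kb Ka) (pqBoxA Kb Ka prec shifts coefB) prec X p) (y := x)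
    (mem_taylorJet_pqLevels (prec := prec) hKb hKa hnd hcoef p hX hx) (D := colMatBoxA (m * winLen Kb Ka) C)
    (vs := colN (n := m * winLen Kb Ka) C)
    (fun j' hj' c' hc' => by
      unfold colMatBoxA
      rw [IntervalD.aget_ofFn _ (hflat hj' hc').1, rdN_of_lt _ hc']
      dsimp only
      rw [(hflat hj' hc').2.1, (hflat hj' hc').2.2]
      exact IntervalD.mem_ofDyad _)
  -- Horner per flat entry
  have hpoly := IntervalD.mem_polyLevelsA prec (n := m * winLen Kb Ka * (m * winLen Kb Ka))
    (Ls := varMatLevelsA (m * winLen Kb Ka) prec (jacLevelsA (pqJacA Kb Ka prec shifts coefB)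
      (IntervalD.jetLevelsA (m * winLen Kb Ka) (pqBoxA Kb Ka prec shifts coefB) prec X p) p) (colMatBoxA (m * winLen Kb Ka) C) p)
    (K := p) (a := fun k t => rdN (varJet (PQcN shifts.toFinset ε₀ α Kb Ka ω) x (colN (n := m * winLen Kb Ka) C (t / (m * winLen Kb Ka))) k)
      (t % (m * winLen Kb Ka)))
    (fun k hk t ht => by
      have hnpos : 0 < m * winLen Kb Ka := by
        rcases Nat.eq_zero_or_pos (m * winLen Kb Ka) with h0 | h0
        · rw [h0] at ht; simp at ht
        · exact h0
      have h := hjets k hk (t / (m * winLen Kb Ka)) (Nat.div_lt_of_lt_mul (by rwa [mul_comm] at ht)) (t % (m * winLen Kb Ka))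
        (Nat.mod_lt t hnpos)
      rwa [Nat.div_add_mod' t (m * winLen Kb Ka)] at h)
    hu (j.val * (m * winLen Kb Ka) + c.val) (hflat j.isLt c.isLt).1
  simp only [(hflat j.isLt c.isLt).2.1, (hflat j.isLt c.isLt).2.2, rdN_of_lt _ c.isLt] at hpoly
  dsimp only [vcolsJ]
  rw [IntervalD.lget_ofFn _ j.isLt, IntervalD.aget_ofFn _ c.isLt]
  -- `wMat c j` is the variational polynomial along column `j`
  exact hpoly

end CertificateGlueOn

end Summit.NavierStokesRegularity.NavierStokesRegularity.Theorems
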